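import Mathlib.Analysis.SpecialFunctions.Integrals.Basic
import Mathlib.Analysis.SpecialFunctions.Complex.Log
import Mathlib.Analysis.Complex.ExponentialBounds
import Mathlib.Analysis.Real.Pi.Bounds
import Mathlib.Algebra.Order.Chebyshev
import Mathlib.NumberTheory.Primorial
import Mathlib.Data.Nat.Log
import Literature.NumberTheory.DiophantineApproximation.KroneckerTheorem
import HarnessLib

/-!
# Turán's localized Kronecker theorem for the logarithms of the primes (Turán 1960, Lemma)

Topic `Literature/NumberTheory/DiophantineApproximation`. Everything in this file is PROVED.

P. Turán, *A theorem on diophantine approximation with application to Riemann zeta-function*,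
Acta Sci. Math. (Szeged) **21** (1960), 311–318, Lemma (p. 313): "If `2 = p₁ < p₂ < … < p_N`
stand for the first `N` primes, `d, β₁, …, β_N` for arbitrary real numbers and `ω` is an
integer `≥ 4`, then there is a `t₀` with `d ≤ t₀ ≤ d + e^{17 ω N log² N}` such that for
`ν = 1, 2, …, N` the inequalities `|t₀ log p_ν − β_ν − e_ν| ≤ 1/ω` (`e_ν` integers) hold, if only
`N > c₆`, `N > ω`." This is the *localized* form of Kronecker's theorem (every interval of the
stated length contains a solution), the tool by which Turán (ibid., §5) deduced the Riemann
hypothesis from zero-free half-STRIPS of the sections `∑_{ν ≤ n} ν^{-s}` (the criterion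
`Literature.Barriers.RiemannHypothesis.Turan1960_criterion`), and by which Montgomery (1983, §1)
localizes the zeros of the sections.

## What is proved

`Literature.NumberTheory.DiophantineApproximation.TuranKronecker.exists_near_forall_prime_le`:
for `n ≥ 4`, `κ > 0` with `⌈2/κ⌉ ≤ n`, arbitrary phases `β_p` and every real `d`, the interval
`[d, d + exp(4 n k / κ)]`, `k = ⌊log₂ n⌋ + 1`, contains a `t` with `|t log p − β_p − e_p| ≤ κ`
(`e_p = round(t log p − β_p) ∈ ℤ`) simultaneously for all primes `p ≤ n`. The length
`exp(4 n (log₂ n + 1)/κ)` has the shape `exp(C ω N log² N)` of the source (`ω = 1/κ`, `N = π(n)`,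
`n ≍ N log N`) with cruder constants and `n` in place of `π(n) log n`; no attempt is made to
optimize (the application in `Literature/Barriers/RiemannHypothesis/` has room `n^ε` to spare).

## Proof (Turán 1960, §§2–4, after Bohr–Jessen)

* Kernel (§2): `K(x) = |∑_{j<m} e(jx)|^{2k}` (`e(x) = exp(2πix)`), a non-negative trigonometric
  polynomial; expanding, `K(x) = ∑_{u} e(ℓ(u) x)` over `u = (w, w') ∈ ([0,m)^k)²`,
  `ℓ(u) = Σ wᵢ − Σ w'ᵢ`, `|ℓ(u)| ≤ k(m−1)`; the number `c₀` of `u` with `ℓ(u) = 0` satisfies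
  `c₀ ≥ m^{2k}/(km)` (Cauchy–Schwarz), and `K(x) ≤ (2‖x‖)^{−2k}` (`‖x‖` = distance to `ℤ`, from
  `|e(x) − 1| ≥ 4‖x‖`). With `m = ⌈2/κ⌉`, `2^k > n`: off `‖x‖ ≤ κ`, `K(x)/c₀ ≤ km·16^{−k} ≤ 1/(4n)`.
* Averaging (§§3–4): for distinct primes `(p_i)`, `∫_d^{d+T} ∏_i K(t log p_i − β_i)/c₀ dt = T + R`,
  `|R| ≤ (km)^{#ι} (∏ p_i)^{k(m−1)}/π`: the frequency `∑_i ℓ(u_i) log p_i` of a term vanishes iff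
  all `ℓ(u_i) = 0` (the `log p` are `ℤ`-independent, the tree's
  `Kronecker.linearIndependent_log_of_prime`), and otherwise is `≥ ∏ p_i^{−|ℓ(u_i)|}` in absolute
  value (`|log A − log B| ≥ 1/max(A, B)` for distinct positive integers), so that its integral is
  `≤ (∏ p_i)^{k(m−1)}/π`.
* If every `t ∈ [d, d+T]` had a bad prime, then pointwise `∏_p K̂ ≤ θ ∑_{p₀} ∏_{p ≠ p₀} K̂` with
  `θ n ≤ 1/4`, and integrating, `T − W ≤ (T + W)/4`, i.e. `T < 2W`, `W = (km)^n (4^n)^{k(m−1)}/π`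
  (primorial bound `∏_{p ≤ n} p ≤ 4^n`); but `2W ≤ exp(4nk/κ) = T`.

## References

* [Turan1960] P. Turán, *A theorem on diophantine approximation with application to Riemann
  zeta-function*, Acta Sci. Math. (Szeged) 21 (1960), 311–318 — Lemma p. 313 and its proof §§2–4
  (read: the Szeged archive copy, `acta.bibl.u-szeged.hu/38581/`).
* H. Bohr, B. Jessen, *Zum Kroneckerschen Satz*, Rend. Circ. Mat. Palermo 57 (1933), 123–129 (the
  kernel idea, as credited by Turán, §3).
* M. Weber, *On localization in Kronecker's diophantine theorem*, arXiv:0806.3990, §1 (restates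
  Turán's Lemma with `T = e^{17 ω N log² N}`).

## Design notes

Phases are normalized to period `1` (`t log p − β_p` close to an integer), as in the source; the
multiplicative form `|p^{2πit} − e(β_p)| ≤ 2πκ` follows from `|e(x) − 1| ≤ 2π‖x‖`. The kernel is
handled through the multi-index expansion `∑_u e(ℓ(u)x)` rather than through its Fourier
coefficients, which avoids extracting coefficients of trigonometric polynomials.
-/

noncomputable section

open Complex Finset MeasureTheory intervalIntegral

namespace Literature.NumberTheory.DiophantineApproximation

namespace TuranKronecker

/-! ### The character `e(x) = exp(2πix)` and the distance to the nearest integer -/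

/-- `e(x) = exp(2π i x)`. [folklore] -/
def e (x : ℝ) : ℂ := cexp (((2 * Real.pi * x : ℝ) : ℂ) * I)

/-- `e(x + y) = e(x) e(y)`. [folklore] -/
theorem e_add (x y : ℝ) : e (x + y) = e x * e y := by
  rw [e, e, e, ← Complex.exp_add]
  congr 1
  push_cast
  ring

/-- `‖e(x)‖ = 1`. [folklore] -/
theorem norm_e (x : ℝ) : ‖e x‖ = 1 := by
  rw [e]
  exact norm_exp_ofReal_mul_I _

/-- `e(0) = 1`. [folklore] -/
@[simp] theorem e_zero : e 0 = 1 := by simp [e]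

/-- `e(n) = 1` for an integer `n`. [folklore] -/
theorem e_intCast (n : ℤ) : e n = 1 := by
  rw [e]
  have : ((2 * Real.pi * (n : ℝ) : ℝ) : ℂ) * I = (n : ℂ) * (2 * Real.pi * I) := by
    push_cast; ring
  rw [this, Complex.exp_int_mul_two_pi_mul_I]

/-- `e` has period `1`: `e(x) = e(x − round x)`. [folklore] -/
theorem e_eq_e_sub_round (x : ℝ) : e x = e (x - round x) := by
  conv_lhs => rw [show x = (x - round x) + (round x : ℝ) by ring]
  rw [e_add, e_intCast, mul_one]

/-- `e(x)` as a sum-exponent: `e(∑ xᵢ) = ∏ e(xᵢ)`. [folklore] -/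
theorem e_sum {ι : Type*} (s : Finset ι) (f : ι → ℝ) : e (∑ i ∈ s, f i) = ∏ i ∈ s, e (f i) := by
  rw [e]
  have : ((2 * Real.pi * (∑ i ∈ s, f i) : ℝ) : ℂ) * I = ∑ i ∈ s, ((2 * Real.pi * f i : ℝ) : ℂ) * I := by
    push_cast
    rw [Finset.mul_sum, Finset.sum_mul]
  rw [this, Complex.exp_sum]
  rfl

/-- `conj e(x) = e(−x)`. [folklore] -/
theorem conj_e (x : ℝ) : (starRingEnd ℂ) (e x) = e (-x) := by
  rw [e, e, ← Complex.exp_conj]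
  congr 1
  simp only [map_mul, Complex.conj_ofReal, Complex.conj_I]
  push_cast
  ring

/-- `e(k x)` for a natural `k` is `e(x)^k`. [folklore] -/
theorem e_natCast_mul (k : ℕ) (x : ℝ) : e (k * x) = e x ^ k := by
  induction k with
  | zero => simp
  | succ k ih =>
    rw [pow_succ, ← ih, ← e_add]
    congr 1
    push_cast
    ring

/-- **`4 ‖x‖ ≤ |e(x) − 1|`**, `‖x‖ = |x − round x|` the distance to the nearest integer (Jordan's
inequality; the tree's `Kronecker.abs_le_norm_cexp_sub_one`). [folklore] -/
theorem four_mul_abs_sub_round_le (x : ℝ) : 4 * |x - round x| ≤ ‖e x - 1‖ := by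
  rw [e_eq_e_sub_round x]
  exact Kronecker.abs_le_norm_cexp_sub_one (abs_sub_round x)

/-- `|e(x) − 1| ≤ 2π ‖x‖` (`|e^{iy} − 1| = 2|sin(y/2)| ≤ |y|`). [folklore] -/
theorem norm_e_sub_one_le (x : ℝ) : ‖e x - 1‖ ≤ 2 * Real.pi * |x - round x| := by
  rw [e_eq_e_sub_round x, e]
  set r : ℝ := x - round x
  rw [mul_comm _ I, Complex.norm_exp_I_mul_ofReal_sub_one, Real.norm_eq_abs, abs_mul, abs_two]
  have h := Real.abs_sin_le_abs (x := 2 * Real.pi * r / 2)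
  have h2 : |2 * Real.pi * r / 2| = Real.pi * |r| := by
    rw [show 2 * Real.pi * r / 2 = Real.pi * r by ring, abs_mul, abs_of_pos Real.pi_pos]
  rw [h2] at h
  linarith

/-! ### The kernel `K(x) = |∑_{j<m} e(jx)|^{2k}` and its multi-index expansion -/

/-- `E_m(x) = ∑_{j < m} e(jx)` (a Dirichlet-kernel-type sum; `|E_m(x)| = |sin πmx / sin πx|`).
[cite: Turan1960, §2 (2.4)] -/
def E (m : ℕ) (x : ℝ) : ℂ := ∑ j : Fin m, e ((j : ℕ) * x)

/-- The multi-indices `u = (w, w') ∈ ([0,m)^k)²` of the expansion of `|E_m|^{2k}`. [folklore] -/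
abbrev U (m k : ℕ) : Type := (Fin k → Fin m) × (Fin k → Fin m)

/-- The frequency `ℓ(u) = ∑ᵢ wᵢ − ∑ᵢ w'ᵢ ∈ ℤ` of the multi-index `u = (w, w')`. [folklore] -/
def ell {m k : ℕ} (u : U m k) : ℤ := (∑ i, ((u.1 i : ℕ) : ℤ)) - ∑ i, ((u.2 i : ℕ) : ℤ)

/-- `|ℓ(u)| ≤ k(m−1)`. [folklore] -/
theorem abs_ell_le {m k : ℕ} (u : U m k) : |ell u| ≤ k * (m - 1 : ℕ) := by
  have h1 : ∀ w : Fin k → Fin m, (0 : ℤ) ≤ ∑ i, ((w i : ℕ) : ℤ) ∧ ∑ i, ((w i : ℕ) : ℤ) ≤ k * (m - 1 : ℕ) := by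
    intro w
    refine ⟨Finset.sum_nonneg fun i _ ↦ by positivity, ?_⟩
    calc ∑ i, ((w i : ℕ) : ℤ) ≤ ∑ _i : Fin k, ((m - 1 : ℕ) : ℤ) := by
          refine Finset.sum_le_sum fun i _ ↦ ?_
          have := (w i).isLt
          exact_mod_cast (show (w i : ℕ) ≤ m - 1 by omega)
      _ = k * (m - 1 : ℕ) := by simp
  obtain ⟨ha0, ha1⟩ := h1 u.1
  obtain ⟨hb0, hb1⟩ := h1 u.2
  rw [ell, abs_le]
  constructor <;> linarith

/-- `E_m(x)^k = ∑_{w ∈ [0,m)^k} e((∑ᵢ wᵢ) x)`. [folklore] -/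
theorem E_pow (m k : ℕ) (x : ℝ) :
    E m x ^ k = ∑ w : Fin k → Fin m, e ((∑ i, ((w i : ℕ) : ℤ) : ℤ) * x) := by
  rw [E, Finset.sum_pow']
  rw [Fintype.piFinset_univ]
  refine Finset.sum_congr rfl fun w _ ↦ ?_
  rw [← e_sum]
  congr 1
  push_cast
  rw [Finset.sum_mul]

/-- `conj(E_m(x))^k = ∑_{w'} e(−(∑ᵢ w'ᵢ) x)`. [folklore] -/
theorem conj_E_pow (m k : ℕ) (x : ℝ) :
    (starRingEnd ℂ) (E m x) ^ k = ∑ w : Fin k → Fin m, e (-((∑ i, ((w i : ℕ) : ℤ) : ℤ) * x)) := by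
  have : (starRingEnd ℂ) (E m x) = ∑ j : Fin m, e (-((j : ℕ) * x)) := by
    rw [E, map_sum]
    exact Finset.sum_congr rfl fun j _ ↦ conj_e _
  rw [this, Finset.sum_pow', Fintype.piFinset_univ]
  refine Finset.sum_congr rfl fun w _ ↦ ?_
  rw [← e_sum]
  congr 1
  push_cast
  rw [Finset.sum_neg_distrib, Finset.sum_mul]

/-- **The multi-index expansion of the kernel**: `|E_m(x)|^{2k} = ∑_{u} e(ℓ(u) x)` (as complex
numbers). [cite: Turan1960, §2 (2.6)] -/
theorem norm_E_pow_eq_sum (m k : ℕ) (x : ℝ) :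
    ((‖E m x‖ ^ (2 * k) : ℝ) : ℂ) = ∑ u : U m k, e (ell u * x) := by
  have h1 : ((‖E m x‖ ^ (2 * k) : ℝ) : ℂ) = (E m x * (starRingEnd ℂ) (E m x)) ^ k := by
    rw [Complex.mul_conj', pow_mul]
    push_cast
    ring
  rw [h1, mul_pow, E_pow, conj_E_pow, Finset.sum_mul_sum, ← Finset.univ_product_univ,
    Finset.sum_product]
  refine Finset.sum_congr rfl fun w _ ↦ Finset.sum_congr rfl fun w' _ ↦ ?_
  rw [← e_add, ell]
  congr 1
  push_cast
  ring

/-- The kernel is bounded by the number of multi-indices: `|E_m(x)|^{2k} ≤ m^{2k}`. [folklore] -/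
theorem norm_E_pow_le (m k : ℕ) (x : ℝ) : ‖E m x‖ ^ (2 * k) ≤ (m : ℝ) ^ (2 * k) := by
  have h : ‖E m x‖ ≤ m := by
    rw [E]
    refine (norm_sum_le _ _).trans ?_
    simp [norm_e]
  exact pow_le_pow_left₀ (norm_nonneg _) h _

/-- **Off-peak decay**: `|E_m(x)| ≤ 1/(2‖x‖)` when `x ∉ ℤ` (geometric sum and `|e(x) − 1| ≥ 4‖x‖`).
[cite: Turan1960, §3 (3.3)] -/
theorem norm_E_le {m : ℕ} {x : ℝ} (hx : x - round x ≠ 0) : ‖E m x‖ ≤ 1 / (2 * |x - round x|) := by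
  have h4 := four_mul_abs_sub_round_le x
  have hpos : 0 < |x - round x| := abs_pos.2 hx
  have hne : e x ≠ 1 := by
    intro h
    rw [h, sub_self, norm_zero] at h4
    linarith
  have hgeom : E m x * (e x - 1) = e x ^ m - 1 := by
    have : E m x = ∑ j ∈ Finset.range m, e x ^ j := by
      rw [E, Finset.sum_range]
      exact Finset.sum_congr rfl fun j _ ↦ e_natCast_mul _ _
    rw [this, geom_sum_mul]
  have hnorm : ‖E m x‖ * ‖e x - 1‖ ≤ 2 := by
    rw [← norm_mul, hgeom]
    calc ‖e x ^ m - 1‖ ≤ ‖e x ^ m‖ + ‖(1 : ℂ)‖ := norm_sub_le _ _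
      _ = 2 := by rw [norm_pow, norm_e, one_pow, norm_one]; norm_num
  have hne' : 0 < ‖e x - 1‖ := by linarith
  rw [le_div_iff₀ (by positivity)]
  nlinarith

/-! ### Counting: the constant term `c₀ = #{u : ℓ(u) = 0} ≥ m^{2k}/(km)` -/

/-- The number `c₀` of multi-indices with frequency `0` (the constant Fourier coefficient
`∫₀¹ |E_m|^{2k}` of the kernel, Turán's `A`). [cite: Turan1960, §2 (2.5)] -/
def c0 (m k : ℕ) : ℕ := #(univ.filter fun u : U m k ↦ ell u = 0)

/-- The digit sum `S(w) = ∑ᵢ wᵢ` of `w ∈ [0,m)^k`. [folklore] -/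
def digitSum {m k : ℕ} (w : Fin k → Fin m) : ℕ := ∑ i, (w i : ℕ)

/-- `S(w) ≤ k(m−1)`. [folklore] -/
theorem digitSum_lt {m k : ℕ} (w : Fin k → Fin m) : digitSum w < k * (m - 1) + 1 := by
  have : digitSum w ≤ k * (m - 1) := by
    calc digitSum w ≤ ∑ _i : Fin k, (m - 1) := Finset.sum_le_sum fun i _ ↦ by
            have := (w i).isLt; omega
      _ = k * (m - 1) := by simp
  omega

/-- `ℓ(w, w') = S(w) − S(w')`. [folklore] -/
theorem ell_eq {m k : ℕ} (u : U m k) : ell u = (digitSum u.1 : ℤ) - (digitSum u.2 : ℤ) := by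
  simp [ell, digitSum]

/-- The number `R(v)` of `w ∈ [0,m)^k` with digit sum `v`. [folklore] -/
def R (m k v : ℕ) : ℕ := #(univ.filter fun w : Fin k → Fin m ↦ digitSum w = v)

/-- `∑_v R(v) = m^k`. [folklore] -/
theorem sum_R (m k : ℕ) : ∑ v ∈ Finset.range (k * (m - 1) + 1), R m k v = m ^ k := by
  have h := Finset.card_eq_sum_card_fiberwise (f := fun w : Fin k → Fin m ↦ digitSum w)
    (s := univ) (t := Finset.range (k * (m - 1) + 1))
    (fun w _ ↦ Finset.mem_range.2 (digitSum_lt w))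
  rw [Finset.card_univ, Fintype.card_fun, Fintype.card_fin, Fintype.card_fin] at h
  rw [h]
  rfl

/-- `c₀ = ∑_v R(v)²`. [folklore] -/
theorem c0_eq_sum_sq (m k : ℕ) : c0 m k = ∑ v ∈ Finset.range (k * (m - 1) + 1), R m k v ^ 2 := by
  rw [c0]
  rw [Finset.card_eq_sum_card_fiberwise (f := fun u : U m k ↦ digitSum u.1)
    (t := Finset.range (k * (m - 1) + 1)) (fun u _ ↦ Finset.mem_range.2 (digitSum_lt u.1))]
  refine Finset.sum_congr rfl fun v _ ↦ ?_
  have hset : (univ.filter fun u : U m k ↦ ell u = 0).filter (fun u ↦ digitSum u.1 = v) =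
      (univ.filter fun w : Fin k → Fin m ↦ digitSum w = v) ×ˢ
        (univ.filter fun w : Fin k → Fin m ↦ digitSum w = v) := by
    ext u
    simp only [Finset.mem_filter, Finset.mem_univ, true_and, Finset.mem_product, ell_eq,
      sub_eq_zero, Nat.cast_inj]
    constructor
    · rintro ⟨h1, h2⟩; exact ⟨h2, h1 ▸ h2⟩
    · rintro ⟨h1, h2⟩; exact ⟨h1.trans h2.symm, h1⟩
  rw [hset, Finset.card_product, R, sq]

/-- **`m^{2k} ≤ (k(m−1)+1) c₀`** (Cauchy–Schwarz on the digit-sum counts; Turán bounds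
`A = ∫₀¹ (sin πmx / sin πx)^{2k} dx` from below in (2.9)). [cite: Turan1960, §2 (2.9)] -/
theorem pow_le_mul_c0 (m k : ℕ) : m ^ (2 * k) ≤ (k * (m - 1) + 1) * c0 m k := by
  have h := sq_sum_le_card_mul_sum_sq (s := Finset.range (k * (m - 1) + 1)) (f := R m k)
  rw [sum_R, Finset.card_range, ← c0_eq_sum_sq, ← pow_mul, mul_comm k 2] at h
  exact h

/-- `c₀ ≥ 1` when `m ≥ 1`. [folklore] -/
theorem c0_pos {m : ℕ} (hm : 1 ≤ m) (k : ℕ) : 0 < c0 m k := by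
  have h := pow_le_mul_c0 m k
  have hm' : 0 < m ^ (2 * k) := pow_pos hm _
  by_contra h0
  push Not at h0
  have : c0 m k = 0 := by omega
  rw [this, mul_zero] at h
  omega

/-- Real form: `m^{2k}/c₀ ≤ km` for `m, k ≥ 1`. [folklore] -/
theorem pow_div_c0_le {m k : ℕ} (hm : 1 ≤ m) (hk : 1 ≤ k) :
    (m : ℝ) ^ (2 * k) / c0 m k ≤ k * m := by
  have hc := c0_pos hm k
  rw [div_le_iff₀ (by exact_mod_cast hc)]
  have h := pow_le_mul_c0 m k
  have h2 : k * (m - 1) + 1 ≤ k * m := by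
    have : k * (m - 1) + k = k * m := by
      rw [← Nat.mul_succ]; congr 1; omega
    omega
  calc ((m : ℝ) ^ (2 * k)) = ((m ^ (2 * k) : ℕ) : ℝ) := by push_cast; ring
    _ ≤ (((k * (m - 1) + 1) * c0 m k : ℕ) : ℝ) := by exact_mod_cast h
    _ ≤ ((k * m * c0 m k : ℕ) : ℝ) := by exact_mod_cast Nat.mul_le_mul_right _ h2
    _ = k * m * (c0 m k : ℝ) := by push_cast; ring

/-! ### The normalized kernel `K̂ = |E_m|^{2k}/c₀` -/

/-- The normalized kernel `K̂(x) = |E_m(x)|^{2k}/c₀` (Turán's `P(x)`, with constant Fourier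
coefficient `1`). [cite: Turan1960, §2 (2.5)–(2.7)] -/
def Khat (m k : ℕ) (x : ℝ) : ℝ := ‖E m x‖ ^ (2 * k) / c0 m k

/-- `K̂ ≥ 0`. [folklore] -/
theorem Khat_nonneg (m k : ℕ) (x : ℝ) : 0 ≤ Khat m k x :=
  div_nonneg (pow_nonneg (norm_nonneg _) _) (Nat.cast_nonneg _)

/-- `K̂` is continuous. [folklore] -/
theorem continuous_Khat (m k : ℕ) : Continuous (Khat m k) := by
  unfold Khat E e
  fun_prop

/-- **Off-peak bound for the normalized kernel**: if `‖x‖ ≥ κ > 0` then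
`K̂(x) ≤ km (2κm)^{−2k}` (`|E_m| ≤ 1/(2κ)` and `c₀ ≥ m^{2k}/(km)`). [cite: Turan1960, §3 (3.3)] -/
theorem Khat_le_of_le_abs {m k : ℕ} (hm : 1 ≤ m) (hk : 1 ≤ k) {κ x : ℝ} (hκ : 0 < κ)
    (hx : κ ≤ |x - round x|) :
    Khat m k x ≤ k * m * (2 * κ * m)⁻¹ ^ (2 * k) := by
  have hx0 : x - round x ≠ 0 := fun h ↦ by rw [h, abs_zero] at hx; linarith
  have hE : ‖E m x‖ ≤ 1 / (2 * κ) := by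
    refine (norm_E_le hx0).trans ?_
    exact one_div_le_one_div_of_le (by positivity) (by linarith)
  have hc : (0 : ℝ) < c0 m k := by exact_mod_cast c0_pos hm k
  have hm0 : (0 : ℝ) < m := by exact_mod_cast hm
  rw [Khat, div_le_iff₀ hc]
  have h1 : ‖E m x‖ ^ (2 * k) ≤ (1 / (2 * κ)) ^ (2 * k) := pow_le_pow_left₀ (norm_nonneg _) hE _
  have h2 : (m : ℝ) ^ (2 * k) ≤ k * m * c0 m k := by
    have := pow_div_c0_le hm hk (m := m)
    rwa [div_le_iff₀ hc] at this
  calc ‖E m x‖ ^ (2 * k) ≤ (1 / (2 * κ)) ^ (2 * k) := h1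
    _ = (2 * κ * m)⁻¹ ^ (2 * k) * (m : ℝ) ^ (2 * k) := by
        rw [← mul_pow]; congr 1; field_simp
    _ ≤ (2 * κ * m)⁻¹ ^ (2 * k) * (k * m * c0 m k) :=
        mul_le_mul_of_nonneg_left h2 (pow_nonneg (by positivity) _)
    _ = k * m * (2 * κ * m)⁻¹ ^ (2 * k) * c0 m k := by ring

/-- The expansion of the normalized kernel: `K̂(x) = c₀⁻¹ ∑_u e(ℓ(u) x)` in `ℂ`. [folklore] -/
theorem Khat_eq_sum (m k : ℕ) (x : ℝ) :
    (Khat m k x : ℂ) = (c0 m k : ℂ)⁻¹ * ∑ u : U m k, e (ell u * x) := by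
  rw [Khat, ← norm_E_pow_eq_sum]
  push_cast
  rw [div_eq_inv_mul]

/-! ### Linear forms in the logarithms of distinct primes -/

/-- **Quantitative independence of the `log p`**: for distinct primes `p_i` and integers `r_i`,
not all zero, with `|r_i| ≤ D`, `|∑ r_i log p_i| ≥ (∏ p_i)^{−D}`. Indeed `∑ r_i log p_i = log A − log B`
with `A = ∏_{r_i > 0} p_i^{r_i} ≠ B = ∏_{r_i < 0} p_i^{−r_i}` (unique factorisation, through the
tree's `Kronecker.linearIndependent_log_of_prime`), and `|log A − log B| ≥ 1/max(A, B) ≥ 1/(AB)`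
for distinct positive integers. [cite: Turan1960, §4 (4.3)–(4.4)] -/
theorem abs_sum_mul_log_ge {ι : Type*} [Fintype ι] {p : ι → ℕ} (hp : ∀ i, (p i).Prime)
    (hinj : Function.Injective p) {r : ι → ℤ} (hr : r ≠ 0) {D : ℕ} (hD : ∀ i, |r i| ≤ D) :
    ((∏ i, (p i : ℝ)) ^ D)⁻¹ ≤ |∑ i, (r i : ℝ) * Real.log (p i)| := by
  classical
  -- the two products
  set A : ℕ := ∏ i, p i ^ (r i).toNat with hA
  set B : ℕ := ∏ i, p i ^ (-r i).toNat with hB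
  have hpos : ∀ i, 0 < p i := fun i ↦ (hp i).pos
  have hA0 : 0 < A := Finset.prod_pos fun i _ ↦ pow_pos (hpos i) _
  have hB0 : 0 < B := Finset.prod_pos fun i _ ↦ pow_pos (hpos i) _
  have hlogA : Real.log A = ∑ i, ((r i).toNat : ℝ) * Real.log (p i) := by
    rw [hA, Nat.cast_prod, Real.log_prod]
    · exact Finset.sum_congr rfl fun i _ ↦ by rw [Nat.cast_pow, Real.log_pow]
    · intro i _; exact_mod_cast (pow_pos (hpos i) _).ne'
  have hlogB : Real.log B = ∑ i, ((-r i).toNat : ℝ) * Real.log (p i) := by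
    rw [hB, Nat.cast_prod, Real.log_prod]
    · exact Finset.sum_congr rfl fun i _ ↦ by rw [Nat.cast_pow, Real.log_pow]
    · intro i _; exact_mod_cast (pow_pos (hpos i) _).ne'
  have hsum : ∑ i, (r i : ℝ) * Real.log (p i) = Real.log A - Real.log B := by
    rw [hlogA, hlogB, ← Finset.sum_sub_distrib]
    refine Finset.sum_congr rfl fun i _ ↦ ?_
    have h := Int.toNat_sub_toNat_neg (r i)
    have h' : (r i : ℝ) = ((r i).toNat : ℝ) - ((-r i).toNat : ℝ) := by exact_mod_cast h.symm
    rw [h']; ring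
  -- `A ≠ B` by linear independence of the `log p_i`
  have hAB : A ≠ B := by
    intro hAB'
    have hzero : ∑ i, (r i : ℝ) * Real.log (p i) = 0 := by rw [hsum, hAB', sub_self]
    -- transfer the tree's independence statement along `i ↦ p i`
    set s : Finset ℕ := Finset.univ.image p with hs
    have hs' : ∀ q ∈ s, q.Prime := by
      intro q hq
      obtain ⟨i, -, rfl⟩ := Finset.mem_image.1 hq
      exact hp i
    have hli := Kronecker.linearIndependent_log_of_prime s hs'
    set f : ι → s := fun i ↦ ⟨p i, Finset.mem_image_of_mem p (Finset.mem_univ i)⟩ with hf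
    have hfinj : Function.Injective f := fun i j h ↦ hinj (by simpa [hf] using h)
    have hli' := hli.comp f hfinj
    rw [Fintype.linearIndependent_iff] at hli'
    have := hli' r (by simpa [hf, zsmul_eq_mul] using hzero)
    exact hr (funext this)
  -- `|log A - log B| ≥ 1 / max A B ≥ 1/(A B)`
  have hAB1 : (1 : ℝ) / ((A : ℝ) * B) ≤ |Real.log A - Real.log B| := by
    have key : ∀ {X Y : ℕ}, 0 < X → X < Y → (1 : ℝ) / ((X : ℝ) * Y) ≤ Real.log Y - Real.log X := by
      intro X Y hX hXY
      have hX' : (0 : ℝ) < X := by exact_mod_cast hX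
      have hY' : (0 : ℝ) < Y := by exact_mod_cast (hX.trans hXY)
      have h1 : (1 : ℝ) ≤ (Y : ℝ) - X := by
        have : (X : ℝ) + 1 ≤ Y := by exact_mod_cast hXY
        linarith
      have hlog : Real.log Y - Real.log X = Real.log (Y / X) := by
        rw [Real.log_div hY'.ne' hX'.ne']
      rw [hlog]
      have h2 := Real.one_sub_inv_le_log_of_pos (div_pos hY' hX')
      rw [inv_div] at h2
      have hX1 : (1 : ℝ) ≤ X := by exact_mod_cast hX
      have h3 : (1 : ℝ) / ((X : ℝ) * Y) ≤ 1 - X / Y := by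
        have e1 : 1 - (X : ℝ) / Y = ((Y : ℝ) - X) / Y := by field_simp
        rw [e1, div_le_div_iff₀ (by positivity) hY']
        have hab : 1 ≤ ((Y : ℝ) - X) * X := by nlinarith
        calc (1 : ℝ) * Y = Y := one_mul _
          _ ≤ (((Y : ℝ) - X) * X) * Y := le_mul_of_one_le_left hY'.le hab
          _ = ((Y : ℝ) - X) * (X * Y) := by ring
      linarith
    rcases lt_or_gt_of_ne hAB with h | h
    · have := key hA0 h
      rw [abs_sub_comm]
      exact this.trans (le_abs_self _)
    · have := key hB0 h
      rw [mul_comm] at this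
      exact this.trans (le_abs_self _)
  -- `A B = ∏ p_i^{|r_i|} ≤ (∏ p_i)^D`
  have hABle : (A : ℝ) * B ≤ (∏ i, (p i : ℝ)) ^ D := by
    have h1 : (A : ℝ) * B = ∏ i, (p i : ℝ) ^ ((r i).toNat + (-r i).toNat) := by
      rw [hA, hB]
      push_cast
      rw [← Finset.prod_mul_distrib]
      exact Finset.prod_congr rfl fun i _ ↦ by rw [pow_add]
    rw [h1, ← Finset.prod_pow]
    refine Finset.prod_le_prod (fun i _ ↦ by positivity) fun i _ ↦ ?_
    refine pow_le_pow_right₀ (by exact_mod_cast (hp i).one_le) ?_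
    have h2 : ((r i).toNat : ℤ) + ((-r i).toNat : ℤ) = |r i| := by
      rcases le_or_gt 0 (r i) with h | h
      · rw [Int.toNat_of_nonneg h, Int.toNat_eq_zero.2 (by omega), abs_of_nonneg h]; ring
      · rw [Int.toNat_eq_zero.2 h.le, Int.toNat_of_nonneg (by omega), abs_of_neg h]; ring
    have := hD i
    omega
  rw [hsum]
  have hP : 0 < (∏ i, (p i : ℝ)) ^ D :=
    pow_pos (Finset.prod_pos fun i _ ↦ by exact_mod_cast hpos i) _
  have hAB0 : (0 : ℝ) < (A : ℝ) * B := by positivity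
  calc ((∏ i, (p i : ℝ)) ^ D)⁻¹ ≤ ((A : ℝ) * B)⁻¹ := by
        rw [inv_le_inv₀ hP hAB0]; exact hABle
    _ = 1 / ((A : ℝ) * B) := (one_div _).symm
    _ ≤ |Real.log A - Real.log B| := hAB1

/-! ### Averaging the product kernel over an interval (Turán 1960, §§3–4) -/

/-- `e` is continuous. [folklore] -/
theorem continuous_e : Continuous e := by
  unfold e; fun_prop

/-- **The oscillatory integral**: for `ω ≠ 0`, `‖∫_d^{d+T} e(tω − c) dt‖ ≤ 1/(π|ω|)`.
[cite: Turan1960, §4 (4.3)] -/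
theorem norm_integral_e_le {ω : ℝ} (hω : ω ≠ 0) (c d T : ℝ) :
    ‖∫ t in d..(d + T), e (t * ω - c)‖ ≤ 1 / (Real.pi * |ω|) := by
  set a : ℂ := ((2 * Real.pi * ω : ℝ) : ℂ) * I with ha
  set b : ℂ := cexp (((2 * Real.pi * (-c) : ℝ) : ℂ) * I) with hb
  have ha0 : a ≠ 0 := by
    rw [ha]
    refine mul_ne_zero ?_ I_ne_zero
    exact_mod_cast (by positivity : 2 * Real.pi * ω ≠ 0)
  have hfun : (fun t : ℝ ↦ e (t * ω - c)) = fun t : ℝ ↦ cexp (a * t) * b := by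
    funext t
    rw [show t * ω - c = ω * t + -c by ring, e_add, e, hb, ha]
    congr 2
    push_cast
    ring
  rw [hfun, intervalIntegral.integral_mul_const, integral_exp_mul_complex ha0]
  have hnb : ‖b‖ = 1 := by rw [hb]; exact norm_exp_ofReal_mul_I _
  have hna : ‖a‖ = 2 * Real.pi * |ω| := by
    rw [ha, norm_mul, Complex.norm_I, mul_one, Complex.norm_real, Real.norm_eq_abs, abs_mul,
      abs_of_pos (by positivity : (0 : ℝ) < 2 * Real.pi)]
  rw [norm_mul, hnb, mul_one, norm_div, hna]
  have h2 : ‖cexp (a * ↑(d + T)) - cexp (a * ↑d)‖ ≤ 2 := by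
    have h1 : ∀ x : ℝ, ‖cexp (a * x)‖ = 1 := fun x ↦ by
      rw [ha, show ((2 * Real.pi * ω : ℝ) : ℂ) * I * (x : ℂ) = ((2 * Real.pi * ω * x : ℝ) : ℂ) * I by
        push_cast; ring]
      exact norm_exp_ofReal_mul_I _
    calc ‖cexp (a * ↑(d + T)) - cexp (a * ↑d)‖ ≤ ‖cexp (a * ↑(d + T))‖ + ‖cexp (a * ↑d)‖ :=
          norm_sub_le _ _
      _ = 2 := by rw [h1, h1]; norm_num
  have hπω : 0 < Real.pi * |ω| := by positivity
  rw [div_le_div_iff₀ (by positivity) hπω]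
  nlinarith

section Averaging

variable {ι : Type*} [Fintype ι] [DecidableEq ι]

/-- The phase `x_i(t) = t log p_i − β_i` of the prime `p_i`. [cite: Turan1960, §3 (3.2)] -/
def phase (p : ι → ℕ) (β : ι → ℝ) (i : ι) (t : ℝ) : ℝ := t * Real.log (p i) - β i

/-- Turán's product kernel `K_N(t) = ∏_i K̂(t log p_i − β_i)`. [cite: Turan1960, §3 (3.2)] -/
def prodKernel (m k : ℕ) (p : ι → ℕ) (β : ι → ℝ) (t : ℝ) : ℝ := ∏ i, Khat m k (phase p β i t)

omit [DecidableEq ι] in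
/-- The product kernel is non-negative. [folklore] -/
theorem prodKernel_nonneg (m k : ℕ) (p : ι → ℕ) (β : ι → ℝ) (t : ℝ) : 0 ≤ prodKernel m k p β t :=
  Finset.prod_nonneg fun _ _ ↦ Khat_nonneg _ _ _

omit [DecidableEq ι] in
/-- The product kernel is continuous in `t`. [folklore] -/
theorem continuous_prodKernel (m k : ℕ) (p : ι → ℕ) (β : ι → ℝ) :
    Continuous (prodKernel m k p β) := by
  unfold prodKernel phase
  refine continuous_finsetProd _ fun i _ ↦ (continuous_Khat m k).comp ?_
  fun_prop

/-- The frequency `∑_i ℓ(v_i) log p_i` of the multi-index family `v`. [folklore] -/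
def freq {m k : ℕ} (p : ι → ℕ) (v : ι → U m k) : ℝ := ∑ i, (ell (v i) : ℝ) * Real.log (p i)

/-- The phase shift `∑_i ℓ(v_i) β_i` of the multi-index family `v`. [folklore] -/
def shift {m k : ℕ} (β : ι → ℝ) (v : ι → U m k) : ℝ := ∑ i, (ell (v i) : ℝ) * β i

/-- **Expansion of the product kernel**:
`∏_i K̂(x_i(t)) = c₀^{−N} ∑_v e(t · freq(v) − shift(v))`. [cite: Turan1960, §4 (4.3)] -/
theorem prodKernel_eq_sum (m k : ℕ) (p : ι → ℕ) (β : ι → ℝ) (t : ℝ) :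
    (prodKernel m k p β t : ℂ) =
      ((c0 m k : ℂ)⁻¹) ^ Fintype.card ι * ∑ v : ι → U m k, e (t * freq p v - shift β v) := by
  classical
  rw [prodKernel, Complex.ofReal_prod]
  simp_rw [Khat_eq_sum]
  rw [Finset.prod_mul_distrib, Finset.prod_const, Finset.card_univ]
  congr 1
  rw [Finset.prod_univ_sum (fun _ ↦ (Finset.univ : Finset (U m k))), Fintype.piFinset_univ]
  refine Finset.sum_congr rfl fun v _ ↦ ?_
  rw [← e_sum]
  congr 1
  rw [freq, shift, Finset.mul_sum, ← Finset.sum_sub_distrib]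
  refine Finset.sum_congr rfl fun i _ ↦ ?_
  rw [phase]; ring

/-- The family of zero-frequency multi-indices: `v` with `ℓ(v_i) = 0` for every `i`. [folklore] -/
def zeroSet (m k : ℕ) (ι : Type*) [Fintype ι] [DecidableEq ι] : Finset (ι → U m k) :=
  Fintype.piFinset fun _ ↦ Finset.univ.filter fun u : U m k ↦ ell u = 0

/-- Membership in the zero-frequency family: all `ℓ(v_i)` vanish. [folklore] -/
theorem mem_zeroSet {m k : ℕ} {v : ι → U m k} : v ∈ zeroSet m k ι ↔ ∀ i, ell (v i) = 0 := by
  simp [zeroSet, Fintype.mem_piFinset]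

/-- `#zeroSet = c₀^N`. [folklore] -/
theorem card_zeroSet (m k : ℕ) : #(zeroSet m k ι) = c0 m k ^ Fintype.card ι := by
  rw [zeroSet, Fintype.card_piFinset, Finset.prod_const, Finset.card_univ, c0]

/-- On the zero set the term is the constant `1`. [folklore] -/
theorem e_eq_one_of_mem_zeroSet {m k : ℕ} (p : ι → ℕ) (β : ι → ℝ) {v : ι → U m k}
    (hv : v ∈ zeroSet m k ι) (t : ℝ) : e (t * freq p v - shift β v) = 1 := by
  rw [mem_zeroSet] at hv
  have h1 : freq p v = 0 := Finset.sum_eq_zero fun i _ ↦ by rw [hv i]; simp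
  have h2 : shift β v = 0 := Finset.sum_eq_zero fun i _ ↦ by rw [hv i]; simp
  rw [h1, h2]; simp

/-- Off the zero set the frequency is bounded away from `0`:
`|freq(v)| ≥ (∏ p_i)^{−k(m−1)}` (distinct primes). [cite: Turan1960, §4 (4.4)] -/
theorem le_abs_freq_of_not_mem_zeroSet {m k : ℕ} {p : ι → ℕ} (hp : ∀ i, (p i).Prime)
    (hinj : Function.Injective p) {v : ι → U m k} (hv : v ∉ zeroSet m k ι) :
    ((∏ i, (p i : ℝ)) ^ (k * (m - 1)))⁻¹ ≤ |freq p v| := by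
  have hr : (fun i ↦ ell (v i)) ≠ 0 := by
    intro h
    apply hv
    rw [mem_zeroSet]
    intro i
    exact congrFun h i
  exact abs_sum_mul_log_ge hp hinj hr (D := k * (m - 1)) fun i ↦ by exact_mod_cast abs_ell_le (v i)

/-- **The mean value of the product kernel** (Turán 1960, §4): for distinct primes `p_i`,
`|∫_d^{d+T} ∏_i K̂(t log p_i − β_i) dt − T| ≤ (km)^N (∏_i p_i)^{k(m−1)} / π`.
[cite: Turan1960, §4 (4.3)–(4.5)] -/
theorem abs_integral_prodKernel_sub_le {m k : ℕ} (hm : 1 ≤ m) (hk : 1 ≤ k) {p : ι → ℕ}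
    (hp : ∀ i, (p i).Prime) (hinj : Function.Injective p) (β : ι → ℝ) (d T : ℝ) :
    |(∫ t in d..(d + T), prodKernel m k p β t) - T| ≤
      ((k : ℝ) * m) ^ Fintype.card ι * (∏ i, (p i : ℝ)) ^ (k * (m - 1)) / Real.pi := by
  classical
  set N : ℕ := Fintype.card ι with hN
  set D : ℕ := k * (m - 1) with hD
  set P : ℝ := ∏ i, (p i : ℝ) with hP
  set Z : Finset (ι → U m k) := zeroSet m k ι with hZ
  set C : ℂ := ((c0 m k : ℂ)⁻¹) ^ N with hC
  have hc0 : (0 : ℝ) < c0 m k := by exact_mod_cast c0_pos hm k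
  have hP0 : 0 < P := Finset.prod_pos fun i _ ↦ by exact_mod_cast (hp i).pos
  -- each term is interval integrable
  have hint : ∀ v : ι → U m k, IntervalIntegrable (fun t : ℝ ↦ e (t * freq p v - shift β v))
      volume d (d + T) := fun v ↦
    (continuous_e.comp (by fun_prop)).intervalIntegrable _ _
  -- the complex form of the integral
  have hJ : (((∫ t in d..(d + T), prodKernel m k p β t) : ℝ) : ℂ) =
      C * ∑ v : ι → U m k, ∫ t in d..(d + T), e (t * freq p v - shift β v) := by
    rw [← intervalIntegral.integral_ofReal]
    simp_rw [prodKernel_eq_sum]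
    rw [intervalIntegral.integral_const_mul, intervalIntegral.integral_finsetSum fun v _ ↦ hint v]
  -- the zero-frequency terms give `T` each
  have hzero : ∑ v ∈ Z, ∫ t in d..(d + T), e (t * freq p v - shift β v) = (c0 m k : ℂ) ^ N * T := by
    have : ∀ v ∈ Z, ∫ t in d..(d + T), e (t * freq p v - shift β v) = (T : ℂ) := by
      intro v hv
      have : (fun t : ℝ ↦ e (t * freq p v - shift β v)) = fun _ ↦ (1 : ℂ) :=
        funext fun t ↦ e_eq_one_of_mem_zeroSet p β hv t
      rw [this, intervalIntegral.integral_const]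
      simp
    rw [Finset.sum_congr rfl this, Finset.sum_const, hZ, card_zeroSet, nsmul_eq_mul]
    push_cast
    ring
  -- hence `J - T = C * (sum over the complement)`
  have hdiff : (((∫ t in d..(d + T), prodKernel m k p β t) : ℝ) : ℂ) - T =
      C * ∑ v ∈ Zᶜ, ∫ t in d..(d + T), e (t * freq p v - shift β v) := by
    rw [hJ, ← Finset.sum_add_sum_compl Z, hzero, mul_add, hC]
    have : ((c0 m k : ℂ)⁻¹) ^ N * ((c0 m k : ℂ) ^ N * T) = T := by
      rw [← mul_assoc, ← mul_pow, inv_mul_cancel₀ (by exact_mod_cast hc0.ne'), one_pow, one_mul]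
    rw [this]; ring
  -- bound each off-zero term
  have hterm : ∀ v ∈ Zᶜ, ‖∫ t in d..(d + T), e (t * freq p v - shift β v)‖ ≤ P ^ D / Real.pi := by
    intro v hv
    rw [Finset.mem_compl] at hv
    have hlow := le_abs_freq_of_not_mem_zeroSet hp hinj hv
    have hPD : 0 < (P ^ D)⁻¹ := by positivity
    have hω : freq p v ≠ 0 := fun h ↦ by rw [h, abs_zero] at hlow; linarith
    refine (norm_integral_e_le hω _ _ _).trans ?_
    rw [div_le_div_iff₀ (by positivity) Real.pi_pos]
    calc 1 * Real.pi = Real.pi * ((P ^ D)⁻¹ * P ^ D) := by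
          rw [inv_mul_cancel₀ (by positivity)]; ring
      _ ≤ Real.pi * (|freq p v| * P ^ D) := by gcongr
      _ = P ^ D * (Real.pi * |freq p v|) := by ring
  -- count the complement
  have hcard : (#Zᶜ : ℝ) ≤ ((m : ℝ) ^ (2 * k)) ^ N := by
    have h1 : #Zᶜ ≤ Fintype.card (ι → U m k) := Finset.card_le_univ _
    have h2 : Fintype.card (ι → U m k) = (m ^ (2 * k)) ^ N := by
      rw [Fintype.card_fun, Fintype.card_prod, Fintype.card_fun, Fintype.card_fin, Fintype.card_fin]
      ring
    calc (#Zᶜ : ℝ) ≤ (Fintype.card (ι → U m k) : ℝ) := by exact_mod_cast h1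
      _ = ((m : ℝ) ^ (2 * k)) ^ N := by rw [h2]; push_cast; ring
  -- assemble
  have hnormC : ‖C‖ = ((c0 m k : ℝ)⁻¹) ^ N := by
    rw [hC, norm_pow, norm_inv, Complex.norm_natCast]
  have key : ‖(((∫ t in d..(d + T), prodKernel m k p β t) : ℝ) : ℂ) - T‖ ≤
      ((k : ℝ) * m) ^ N * P ^ D / Real.pi := by
    rw [hdiff, norm_mul, hnormC]
    calc ((c0 m k : ℝ)⁻¹) ^ N * ‖∑ v ∈ Zᶜ, ∫ t in d..(d + T), e (t * freq p v - shift β v)‖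
        ≤ ((c0 m k : ℝ)⁻¹) ^ N * ∑ v ∈ Zᶜ, ‖∫ t in d..(d + T), e (t * freq p v - shift β v)‖ := by
          gcongr; exact norm_sum_le _ _
      _ ≤ ((c0 m k : ℝ)⁻¹) ^ N * ∑ _v ∈ Zᶜ, P ^ D / Real.pi := by
          gcongr with v hv; exact hterm v hv
      _ = ((c0 m k : ℝ)⁻¹) ^ N * #Zᶜ * (P ^ D / Real.pi) := by
          rw [Finset.sum_const, nsmul_eq_mul]; ring
      _ ≤ ((c0 m k : ℝ)⁻¹) ^ N * ((m : ℝ) ^ (2 * k)) ^ N * (P ^ D / Real.pi) := by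
          gcongr
      _ = ((m : ℝ) ^ (2 * k) / c0 m k) ^ N * (P ^ D / Real.pi) := by
          rw [← mul_pow]; congr 1; rw [div_eq_inv_mul]
      _ ≤ ((k : ℝ) * m) ^ N * (P ^ D / Real.pi) := by
          gcongr
          exact pow_div_c0_le hm hk
      _ = ((k : ℝ) * m) ^ N * P ^ D / Real.pi := by ring
  have hre : ‖(((∫ t in d..(d + T), prodKernel m k p β t) : ℝ) : ℂ) - T‖ =
      |(∫ t in d..(d + T), prodKernel m k p β t) - T| := by
    rw [← Complex.ofReal_sub, Complex.norm_real, Real.norm_eq_abs]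
  rw [← hre]
  exact key

/-- The mean value with one prime dropped: for `i₀ : ι`,
`∫_d^{d+T} ∏_{i ≠ i₀} K̂(x_i(t)) dt ≤ T + (km)^N (∏_i p_i)^{k(m−1)}/π` (the previous estimate for
the subfamily `(p_i)_{i ≠ i₀}`). [cite: Turan1960, §4] -/
theorem integral_prod_erase_le {m k : ℕ} (hm : 1 ≤ m) (hk : 1 ≤ k) {p : ι → ℕ}
    (hp : ∀ i, (p i).Prime) (hinj : Function.Injective p) (β : ι → ℝ) (d T : ℝ) (i₀ : ι) :
    (∫ t in d..(d + T), ∏ i ∈ Finset.univ.erase i₀, Khat m k (phase p β i t)) ≤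
      T + ((k : ℝ) * m) ^ Fintype.card ι * (∏ i, (p i : ℝ)) ^ (k * (m - 1)) / Real.pi := by
  classical
  -- pass to the subtype `{i // i ≠ i₀}`
  set p' : {i : ι // i ≠ i₀} → ℕ := fun j ↦ p j.1 with hp'
  set β' : {i : ι // i ≠ i₀} → ℝ := fun j ↦ β j.1 with hβ'
  have hmem : ∀ x : ι, x ∈ Finset.univ.erase i₀ ↔ x ≠ i₀ := fun x ↦ by simp
  have hprod : ∀ t : ℝ, ∏ i ∈ Finset.univ.erase i₀, Khat m k (phase p β i t) =
      prodKernel m k p' β' t := fun t ↦ by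
    rw [Finset.prod_subtype (F := inferInstance) (Finset.univ.erase i₀) hmem
      (fun i ↦ Khat m k (phase p β i t))]
    rfl
  simp_rw [hprod]
  have hinj' : Function.Injective p' := fun a b h ↦ Subtype.ext (hinj h)
  have h := abs_integral_prodKernel_sub_le hm hk (fun j ↦ hp j.1) hinj' β' d T
  have h1 := (abs_le.1 h).2
  -- compare the error terms
  have hkm : (1 : ℝ) ≤ (k : ℝ) * m := by
    have : (1 : ℝ) ≤ k := by exact_mod_cast hk
    have : (1 : ℝ) ≤ m := by exact_mod_cast hm
    nlinarith
  have hcard : Fintype.card {i : ι // i ≠ i₀} ≤ Fintype.card ι := Fintype.card_subtype_le _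
  have hpow : ((k : ℝ) * m) ^ Fintype.card {i : ι // i ≠ i₀} ≤ ((k : ℝ) * m) ^ Fintype.card ι :=
    pow_le_pow_right₀ hkm hcard
  have hP : (∏ j, (p' j : ℝ)) ≤ ∏ i, (p i : ℝ) := by
    have h1 : (∏ j, (p' j : ℝ)) = ∏ i ∈ Finset.univ.erase i₀, (p i : ℝ) := by
      rw [Finset.prod_subtype (F := inferInstance) (Finset.univ.erase i₀) hmem (fun i ↦ (p i : ℝ))]
    rw [h1, ← Finset.mul_prod_erase Finset.univ (fun i ↦ (p i : ℝ)) (Finset.mem_univ i₀)]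
    refine le_mul_of_one_le_left (Finset.prod_nonneg fun i _ ↦ by positivity) ?_
    exact_mod_cast (hp i₀).one_le
  have hP0 : 0 ≤ ∏ j, (p' j : ℝ) := Finset.prod_nonneg fun j _ ↦ by positivity
  have hPD : (∏ j, (p' j : ℝ)) ^ (k * (m - 1)) ≤ (∏ i, (p i : ℝ)) ^ (k * (m - 1)) :=
    pow_le_pow_left₀ hP0 hP _
  have : ((k : ℝ) * m) ^ Fintype.card {i : ι // i ≠ i₀} * (∏ j, (p' j : ℝ)) ^ (k * (m - 1)) / Real.pi
      ≤ ((k : ℝ) * m) ^ Fintype.card ι * (∏ i, (p i : ℝ)) ^ (k * (m - 1)) / Real.pi := by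
    gcongr
  linarith

end Averaging

/-! ### The localized Kronecker theorem -/

/-- Numerics I: with `m = ⌈2/κ⌉`, `k = ⌊log₂ n⌋ + 1`, `m ≤ n`, `4 ≤ n`, the off-peak value
`θ = km (2κm)^{−2k}` satisfies `θ n ≤ 1/4`. [folklore] -/
theorem theta_mul_le {n : ℕ} (hn : 4 ≤ n) {κ : ℝ} (hκ : 0 < κ) (hκn : (⌈2 / κ⌉₊ : ℕ) ≤ n) :
    ((Nat.log 2 n + 1 : ℕ) : ℝ) * (⌈2 / κ⌉₊ : ℕ) * (2 * κ * (⌈2 / κ⌉₊ : ℕ))⁻¹ ^ (2 * (Nat.log 2 n + 1))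
      * n ≤ 1 / 4 := by
  set m : ℕ := ⌈2 / κ⌉₊ with hm
  set k : ℕ := Nat.log 2 n + 1 with hk
  have hm2 : (2 : ℝ) / κ ≤ m := Nat.le_ceil _
  have hκm : (4 : ℝ) ≤ 2 * κ * m := by
    have : 2 * κ * (2 / κ) = 4 := by field_simp; norm_num
    nlinarith
  have hinv : (2 * κ * (m : ℝ))⁻¹ ≤ 1 / 4 := by
    rw [one_div]; exact inv_anti₀ (by norm_num) hκm
  have hinv0 : 0 ≤ (2 * κ * (m : ℝ))⁻¹ := by positivity
  have h2k : n < 2 ^ k := Nat.lt_pow_succ_log_self one_lt_two n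
  have hk_le : k ≤ n := by
    have := Nat.log_lt_self 2 (show n ≠ 0 by omega)
    omega
  have hn0 : (0 : ℝ) < n := by exact_mod_cast (show 0 < n by omega)
  -- `θ n ≤ k m n (1/4)^{2k} = k m n / 16^k` and `16^k = (2^k)^4 > n^4 ≥ 4 k m n`
  have hpow : (2 * κ * (m : ℝ))⁻¹ ^ (2 * k) ≤ (1 / 4) ^ (2 * k) := pow_le_pow_left₀ hinv0 hinv _
  have h16 : ((n : ℝ) + 1) ^ 4 ≤ (16 : ℝ) ^ k := by
    have h1 : (n : ℝ) + 1 ≤ (2 : ℝ) ^ k := by exact_mod_cast h2k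
    calc ((n : ℝ) + 1) ^ 4 ≤ ((2 : ℝ) ^ k) ^ 4 := pow_le_pow_left₀ (by positivity) h1 4
      _ = 16 ^ k := by rw [← pow_mul, mul_comm, pow_mul]; norm_num
  have hkn : (k : ℝ) ≤ n := by exact_mod_cast hk_le
  have hmn : (m : ℝ) ≤ n := by exact_mod_cast hκn
  have hn4 : (4 : ℝ) ≤ n := by exact_mod_cast hn
  have hquarter : ((1 : ℝ) / 4) ^ (2 * k) = ((16 : ℝ) ^ k)⁻¹ := by
    rw [pow_mul, show ((1 : ℝ) / 4) ^ 2 = 16⁻¹ by norm_num, inv_pow]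
  calc (k : ℝ) * m * (2 * κ * (m : ℝ))⁻¹ ^ (2 * k) * n
      ≤ (k : ℝ) * m * (1 / 4) ^ (2 * k) * n := by gcongr
    _ = (k : ℝ) * m * n / 16 ^ k := by rw [hquarter]; ring
    _ ≤ (n : ℝ) * n * n / (n + 1) ^ 4 := by
        rw [div_le_div_iff₀ (by positivity) (by positivity)]
        have : (k : ℝ) * m * n ≤ n * n * n := by gcongr
        exact mul_le_mul this h16 (by positivity) (by positivity)
    _ ≤ 1 / 4 := by
        rw [div_le_div_iff₀ (by positivity) (by norm_num)]
        nlinarith [pow_le_pow_left₀ hn0.le (by linarith : (n : ℝ) ≤ n + 1) 3,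
          sq_nonneg ((n : ℝ) + 1)]

/-- Numerics II: with the same parameters and `κ < 1/2`,
`2 (km)^n (4^n)^{k(m−1)}/π ≤ exp(4 n k/κ)`. [folklore] -/
theorem two_mul_W_le_exp {n : ℕ} (hn : 4 ≤ n) {κ : ℝ} (hκ : 0 < κ) (hκ2 : κ < 1 / 2)
    (hκn : (⌈2 / κ⌉₊ : ℕ) ≤ n) :
    2 * ((((Nat.log 2 n + 1 : ℕ) : ℝ) * (⌈2 / κ⌉₊ : ℕ)) ^ n *
      ((4 : ℝ) ^ n) ^ ((Nat.log 2 n + 1) * (⌈2 / κ⌉₊ - 1)) / Real.pi)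
      ≤ Real.exp (4 * n * (Nat.log 2 n + 1 : ℕ) / κ) := by
  set m : ℕ := ⌈2 / κ⌉₊ with hm
  set k : ℕ := Nat.log 2 n + 1 with hk
  have hn0 : (0 : ℝ) < n := by exact_mod_cast (show 0 < n by omega)
  have hn1 : (1 : ℝ) ≤ n := by exact_mod_cast (show 1 ≤ n by omega)
  have hk1 : (1 : ℝ) ≤ k := by exact_mod_cast (show 1 ≤ k by omega)
  have hm_lt : (m : ℝ) < 2 / κ + 1 := Nat.ceil_lt_add_one (by positivity)
  have hm4 : (4 : ℝ) < m := by
    have : (4 : ℝ) < 2 / κ := by rw [lt_div_iff₀ hκ]; linarith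
    exact this.trans_le (Nat.le_ceil _)
  have hm1 : 1 ≤ m := by exact_mod_cast (show (1 : ℝ) ≤ m by linarith)
  have hm1' : ((m - 1 : ℕ) : ℝ) = m - 1 := by push_cast [Nat.cast_sub hm1]; ring
  have hmsub : ((m - 1 : ℕ) : ℝ) ≤ 2 / κ := by rw [hm1']; linarith
  have hkm0 : 0 < (k : ℝ) * m := by positivity
  -- take logarithms
  set W2 : ℝ := 2 * ((((k : ℕ) : ℝ) * (m : ℕ)) ^ n * ((4 : ℝ) ^ n) ^ (k * (m - 1)) / Real.pi) with hW2
  have hW2pos : 0 < W2 := by positivity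
  rw [← Real.exp_log hW2pos, Real.exp_le_exp]
  have hlog : Real.log W2 = Real.log 2 + (n * Real.log (k * m) + (k * (m - 1 : ℕ) : ℝ) * (n * Real.log 4))
      - Real.log Real.pi := by
    rw [hW2, Real.log_mul (by norm_num) (by positivity), Real.log_div (by positivity) Real.pi_pos.ne',
      Real.log_mul (by positivity) (by positivity), Real.log_pow, Real.log_pow, Real.log_pow]
    push_cast
    ring
  rw [hlog]
  -- the elementary bounds
  have hlog2 : Real.log 2 < 0.6932 := lt_of_lt_of_le Real.log_two_lt_d9 (by norm_num)
  have hlog4 : Real.log 4 < 1.4 := by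
    rw [show (4 : ℝ) = 2 ^ 2 by norm_num, Real.log_pow]; push_cast; linarith
  have hlogπ : Real.log 2 ≤ Real.log Real.pi :=
    Real.log_le_log (by norm_num) (by linarith [Real.pi_gt_three])
  have h2k : (n : ℝ) < (2 : ℝ) ^ k := by exact_mod_cast Nat.lt_pow_succ_log_self one_lt_two n
  have hlogn : Real.log n < k * Real.log 2 := by
    rw [← Real.log_pow]; exact Real.log_lt_log hn0 h2k
  have hlogkm : Real.log (k * m) ≤ 2 * Real.log n := by
    have hkn : (k : ℝ) ≤ n := by
      have := Nat.log_lt_self 2 (show n ≠ 0 by omega)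
      exact_mod_cast (show k ≤ n by omega)
    have hmn : (m : ℝ) ≤ n := by exact_mod_cast hκn
    have h2 : Real.log ((n : ℝ) ^ 2) = 2 * Real.log n := by rw [Real.log_pow]; norm_num
    rw [← h2]
    exact Real.log_le_log hkm0 (by nlinarith)
  have hlogn0 : 0 ≤ Real.log n := Real.log_nonneg hn1
  -- `n log(km) ≤ 2 n log n ≤ 1.4 n k ≤ 0.7 n k / κ`
  have hA : (n : ℝ) * Real.log (k * m) ≤ 0.7 * (n * k / κ) := by
    have h1 : (n : ℝ) * Real.log (k * m) ≤ n * (2 * (k * Real.log 2)) := by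
      gcongr; linarith
    have hnk0 : 0 ≤ (n : ℝ) * k := by positivity
    have h2 : (n : ℝ) * (2 * (k * Real.log 2)) ≤ 1.4 * (n * k) := by
      calc (n : ℝ) * (2 * (k * Real.log 2)) = (n * k) * (2 * Real.log 2) := by ring
        _ ≤ (n * k) * 1.4 := mul_le_mul_of_nonneg_left (by linarith) hnk0
        _ = 1.4 * (n * k) := by ring
    have h3 : (n : ℝ) * k ≤ (n * k / κ) * (1 / 2) := by
      rw [div_mul_eq_mul_div, le_div_iff₀ hκ]
      have : 0 ≤ (n : ℝ) * k := by positivity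
      nlinarith
    linarith
  -- `k(m-1) n log 4 ≤ 1.4 · k (2/κ) n = 2.8 n k /κ`
  have hB : (k * (m - 1 : ℕ) : ℝ) * (n * Real.log 4) ≤ 2.8 * (n * k / κ) := by
    have h1 : (k * (m - 1 : ℕ) : ℝ) ≤ k * (2 / κ) := by gcongr
    have h2 : (n : ℝ) * Real.log 4 ≤ n * 1.4 := by gcongr
    calc (k * (m - 1 : ℕ) : ℝ) * (n * Real.log 4) ≤ (k * (2 / κ)) * (n * 1.4) :=
          mul_le_mul h1 h2 (by positivity) (by positivity)
      _ = 2.8 * (n * k / κ) := by ring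
  have hnk : 0 ≤ (n : ℝ) * k / κ := by positivity
  have : (4 : ℝ) * n * (k : ℕ) / κ = 4 * (n * k / κ) := by ring
  rw [this]
  linarith

/-- **Turán's localized Kronecker theorem for the logarithms of the primes** (Turán 1960, Lemma,
p. 313, in an explicit crude form): for `n ≥ 4`, `κ > 0` with `⌈2/κ⌉ ≤ n`, arbitrary phases `β_p`
and EVERY real `d`, the interval `[d, d + exp(4 n (⌊log₂ n⌋ + 1)/κ)]` contains a `t` such that
`|t log p − β_p − e_p| ≤ κ` with integers `e_p = round(t log p − β_p)`, simultaneously for all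
primes `p ≤ n`. (Source: interval length `e^{17 ω N log² N}` for the first `N` primes, precision
`1/ω`, `N > c₆`, `N > ω`.) [cite: Turan1960, Lemma p. 313] -/
theorem exists_near_forall_prime_le {n : ℕ} (hn : 4 ≤ n) {κ : ℝ} (hκ : 0 < κ)
    (hκn : (⌈2 / κ⌉₊ : ℕ) ≤ n) (β : ℕ → ℝ) (d : ℝ) :
    ∃ t ∈ Set.Icc d (d + Real.exp (4 * n * (Nat.log 2 n + 1 : ℕ) / κ)),
      ∀ p : ℕ, p.Prime → p ≤ n → |t * Real.log p - β p - round (t * Real.log p - β p)| ≤ κ := by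
  classical
  set T : ℝ := Real.exp (4 * n * (Nat.log 2 n + 1 : ℕ) / κ) with hT
  have hT0 : 0 < T := Real.exp_pos _
  -- trivial when `κ ≥ 1/2`
  rcases le_or_gt (1 / 2 : ℝ) κ with hκ2 | hκ2
  · refine ⟨d, ⟨le_rfl, by linarith⟩, fun p _ _ ↦ (abs_sub_round _).trans hκ2⟩
  by_contra hcon
  push Not at hcon
  -- parameters and the index type of the primes `≤ n`
  set m : ℕ := ⌈2 / κ⌉₊ with hm
  set k : ℕ := Nat.log 2 n + 1 with hk
  set S : Finset ℕ := (Finset.range (n + 1)).filter Nat.Prime with hS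
  have hSmem : ∀ q : ℕ, q ∈ S ↔ q.Prime ∧ q ≤ n := fun q ↦ by
    simp only [hS, Finset.mem_filter, Finset.mem_range]; constructor <;> rintro ⟨h1, h2⟩
    · exact ⟨h2, by omega⟩
    · exact ⟨by omega, h1⟩
  set pS : S → ℕ := fun i ↦ i.1 with hpS
  set βS : S → ℝ := fun i ↦ β i.1 with hβS
  have hpP : ∀ i : S, (pS i).Prime := fun i ↦ ((hSmem i.1).1 i.2).1
  have hpinj : Function.Injective pS := fun a b h ↦ Subtype.ext h
  have hm1 : 1 ≤ m := by
    have : (0 : ℝ) < 2 / κ := by positivity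
    exact Nat.lt_ceil.2 (by simpa using this)
  have hk1 : 1 ≤ k := by omega
  have hκm : (2 : ℝ) / κ ≤ m := Nat.le_ceil _
  -- the off-peak value `θ`
  set θ : ℝ := (k : ℝ) * m * (2 * κ * (m : ℝ))⁻¹ ^ (2 * k) with hθ
  have hθ0 : 0 ≤ θ := by positivity
  -- cardinality of `S`
  set N : ℕ := Fintype.card S with hN
  have hNn : N ≤ n := by
    rw [hN, Fintype.card_coe]
    calc #S ≤ #(Finset.Icc 1 n) := Finset.card_le_card fun q hq ↦ by
            rw [Finset.mem_Icc]; exact ⟨((hSmem q).1 hq).1.one_le, ((hSmem q).1 hq).2⟩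
      _ = n := by simp
  have hθN : θ * N ≤ 1 / 4 := by
    have h := theta_mul_le hn hκ hκn
    have hNn' : (N : ℝ) ≤ n := by exact_mod_cast hNn
    calc θ * N ≤ θ * n := mul_le_mul_of_nonneg_left hNn' hθ0
      _ ≤ 1 / 4 := by rw [hθ]; exact_mod_cast h
  -- pointwise domination on `[d, d + T]`
  have hpt : ∀ t ∈ Set.Icc d (d + T), prodKernel m k pS βS t ≤
      θ * ∑ i₀ : S, ∏ i ∈ Finset.univ.erase i₀, Khat m k (phase pS βS i t) := by
    intro t ht
    obtain ⟨q, hq, hqn, hbad⟩ := hcon t ht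
    set i₁ : S := ⟨q, (hSmem q).2 ⟨hq, hqn⟩⟩ with hi₁
    have hK : Khat m k (phase pS βS i₁ t) ≤ θ := by
      rw [hθ]
      exact Khat_le_of_le_abs hm1 hk1 hκ (by simpa [phase, hpS, hβS, hi₁] using hbad.le)
    have hsplit : prodKernel m k pS βS t =
        Khat m k (phase pS βS i₁ t) * ∏ i ∈ Finset.univ.erase i₁, Khat m k (phase pS βS i t) := by
      rw [prodKernel, ← Finset.mul_prod_erase Finset.univ (fun i ↦ Khat m k (phase pS βS i t))
        (Finset.mem_univ i₁)]
    have hrest : 0 ≤ ∏ i ∈ Finset.univ.erase i₁, Khat m k (phase pS βS i t) :=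
      Finset.prod_nonneg fun i _ ↦ Khat_nonneg _ _ _
    rw [hsplit]
    calc Khat m k (phase pS βS i₁ t) * ∏ i ∈ Finset.univ.erase i₁, Khat m k (phase pS βS i t)
        ≤ θ * ∏ i ∈ Finset.univ.erase i₁, Khat m k (phase pS βS i t) :=
          mul_le_mul_of_nonneg_right hK hrest
      _ ≤ θ * ∑ i₀ : S, ∏ i ∈ Finset.univ.erase i₀, Khat m k (phase pS βS i t) := by
          gcongr
          exact Finset.single_le_sum (f := fun i₀ : S ↦ ∏ i ∈ Finset.univ.erase i₀,
            Khat m k (phase pS βS i t)) (fun i₀ _ ↦ Finset.prod_nonneg fun i _ ↦ Khat_nonneg _ _ _)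
            (Finset.mem_univ i₁)
  -- integrate the domination
  have hcont_erase : ∀ i₀ : S, Continuous fun t : ℝ ↦
      ∏ i ∈ Finset.univ.erase i₀, Khat m k (phase pS βS i t) := fun i₀ ↦ by
    refine continuous_finsetProd _ fun i _ ↦ (continuous_Khat m k).comp ?_
    unfold phase; fun_prop
  have hJle : (∫ t in d..(d + T), prodKernel m k pS βS t) ≤
      θ * ∑ i₀ : S, ∫ t in d..(d + T), ∏ i ∈ Finset.univ.erase i₀, Khat m k (phase pS βS i t) := by
    have h1 : (∫ t in d..(d + T), prodKernel m k pS βS t) ≤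
        ∫ t in d..(d + T), θ * ∑ i₀ : S, ∏ i ∈ Finset.univ.erase i₀, Khat m k (phase pS βS i t) :=
      intervalIntegral.integral_mono_on (by linarith)
        ((continuous_prodKernel m k pS βS).intervalIntegrable _ _)
        ((continuous_const.mul (continuous_finsetSum _ fun i₀ _ ↦ hcont_erase i₀)).intervalIntegrable
          _ _) hpt
    rw [intervalIntegral.integral_const_mul,
      intervalIntegral.integral_finsetSum fun i₀ _ ↦ (hcont_erase i₀).intervalIntegrable _ _] at h1
    exact h1
  -- the mean values
  set W : ℝ := ((k : ℝ) * m) ^ N * (∏ i : S, (pS i : ℝ)) ^ (k * (m - 1)) / Real.pi with hW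
  have hJge : T - W ≤ ∫ t in d..(d + T), prodKernel m k pS βS t := by
    have h := abs_integral_prodKernel_sub_le hm1 hk1 hpP hpinj βS d T
    have := (abs_le.1 h).1
    rw [hW]; linarith
  have hJi : ∀ i₀ : S, (∫ t in d..(d + T), ∏ i ∈ Finset.univ.erase i₀, Khat m k (phase pS βS i t))
      ≤ T + W := fun i₀ ↦ integral_prod_erase_le hm1 hk1 hpP hpinj βS d T i₀
  have hsum : ∑ i₀ : S, (∫ t in d..(d + T), ∏ i ∈ Finset.univ.erase i₀, Khat m k (phase pS βS i t))
      ≤ N * (T + W) := by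
    calc ∑ i₀ : S, (∫ t in d..(d + T), ∏ i ∈ Finset.univ.erase i₀, Khat m k (phase pS βS i t))
        ≤ ∑ _i₀ : S, (T + W) := Finset.sum_le_sum fun i₀ _ ↦ hJi i₀
      _ = N * (T + W) := by rw [Finset.sum_const, Finset.card_univ, nsmul_eq_mul]
  -- `W ≤ (km)^n (4^n)^{k(m-1)}/π` and `2 W' ≤ T`
  have hW0 : 0 ≤ W := by rw [hW]; positivity
  have hWle : W ≤ ((k : ℝ) * m) ^ n * ((4 : ℝ) ^ n) ^ (k * (m - 1)) / Real.pi := by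
    have hkm : (1 : ℝ) ≤ (k : ℝ) * m := by
      have : (1 : ℝ) ≤ k := by exact_mod_cast hk1
      have : (1 : ℝ) ≤ m := by exact_mod_cast hm1
      nlinarith
    have hprim : (∏ i : S, (pS i : ℝ)) ≤ (4 : ℝ) ^ n := by
      have h1 : (∏ i : S, (pS i : ℝ)) = ((primorial n : ℕ) : ℝ) := by
        rw [primorial, Nat.cast_prod, ← Finset.prod_coe_sort S]
      rw [h1]
      exact_mod_cast primorial_le_four_pow n
    have hP0 : 0 ≤ ∏ i : S, (pS i : ℝ) := Finset.prod_nonneg fun i _ ↦ by positivity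
    rw [hW]
    have hpow : ((k : ℝ) * m) ^ N ≤ ((k : ℝ) * m) ^ n := pow_le_pow_right₀ hkm hNn
    have hPD : (∏ i : S, (pS i : ℝ)) ^ (k * (m - 1)) ≤ ((4 : ℝ) ^ n) ^ (k * (m - 1)) :=
      pow_le_pow_left₀ hP0 hprim _
    gcongr
  have h2W : 2 * (((k : ℝ) * m) ^ n * ((4 : ℝ) ^ n) ^ (k * (m - 1)) / Real.pi) ≤ T := by
    have := two_mul_W_le_exp hn hκ hκ2 hκn
    rw [hT]
    exact_mod_cast this
  -- contradiction: `T - W ≤ θ N (T + W) ≤ (T + W)/4`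
  have hfin : T - W ≤ (T + W) / 4 := by
    have h0 : 0 ≤ T + W := by linarith
    calc T - W ≤ θ * ∑ i₀ : S, ∫ t in d..(d + T),
          ∏ i ∈ Finset.univ.erase i₀, Khat m k (phase pS βS i t) := hJge.trans hJle
      _ ≤ θ * (N * (T + W)) := mul_le_mul_of_nonneg_left hsum hθ0
      _ = θ * N * (T + W) := by ring
      _ ≤ 1 / 4 * (T + W) := mul_le_mul_of_nonneg_right hθN h0
      _ = (T + W) / 4 := by ring
  linarith

/-- **Multiplicative form** (the shape used with Bohr's bookkeeping for the sections of `ζ`):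
under the same hypotheses the interval contains a `t` with `‖p^{2πit} − e(β_p)‖ ≤ 2πκ` for all
primes `p ≤ n` (`p^{2πit} = e(t log p)` and `|e(x) − e(β)| = |e(x − β) − 1| ≤ 2π‖x − β‖`).
[cite: Turan1960, Lemma p. 313] -/
theorem exists_near_forall_prime_norm_cpow_sub_e_le {n : ℕ} (hn : 4 ≤ n) {κ : ℝ} (hκ : 0 < κ)
    (hκn : (⌈2 / κ⌉₊ : ℕ) ≤ n) (β : ℕ → ℝ) (d : ℝ) :
    ∃ t ∈ Set.Icc d (d + Real.exp (4 * n * (Nat.log 2 n + 1 : ℕ) / κ)),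
      ∀ p : ℕ, p.Prime → p ≤ n →
        ‖(p : ℂ) ^ (((2 * Real.pi * t : ℝ) : ℂ) * I) - e (β p)‖ ≤ 2 * Real.pi * κ := by
  obtain ⟨t, ht, h⟩ := exists_near_forall_prime_le hn hκ hκn β d
  refine ⟨t, ht, fun p hp hpn ↦ ?_⟩
  have h1 : (p : ℂ) ^ (((2 * Real.pi * t : ℝ) : ℂ) * I) = e (t * Real.log p) := by
    rw [cpow_def_of_ne_zero (Nat.cast_ne_zero.2 hp.ne_zero), ← natCast_log, e]
    congr 1
    push_cast
    ring
  have h2 : e (t * Real.log p) - e (β p) = e (β p) * (e (t * Real.log p - β p) - 1) := by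
    rw [mul_sub, mul_one, ← e_add]
    congr 1
    ring_nf
  rw [h1, h2, norm_mul, norm_e, one_mul]
  refine (norm_e_sub_one_le _).trans ?_
  have := h p hp hpn
  nlinarith [Real.pi_pos]

end TuranKronecker

end Literature.NumberTheory.DiophantineApproximation

end
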